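import Summits.Parity.GeneralizedHardyLittlewood.Theorems.PolymathEpsThreeCeilingGridBoundHighRankActivityFiveBudget
import Literature.Analysis.ValidatedNumerics.TaylorModelIntegralCert2DElem

/-!
# Route `PolymathEpsThreeCeiling`, crux `GridBoundHigh` (stmt-Parity-19069): the fibre budget `fiveBudget` as a
# `BExprE` straight-line program (for kernel-checked Taylor-model range certificates)

The 24 remaining real inequalities "R1 at `j`" (`…GridBoundHighOfR1.lean`: `fiveBudget ε Λ β d₁₀ d₀ c s₀ s₁ ≤ 1` on
`0 < s₁ ≤ s₀`, `s₀ + s₁ ≤ 1 - ε`) are proved by bivariate Taylor-model range certificates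
(`Literature.Analysis.ValidatedNumerics.PolyMP.BExprE.model`, kernel-reduced).  This file rewrites `fiveBudget`, with its
`min`/`max` breakpoints RESOLVED, as terms of the certificate language `BExprE` (`const, x, y, +, −, ·, log, ⁻¹`) in the
coordinates `x = s₀`, `y = s₁ / s₀` (piece A: `2 s₀ ≤ 1 - ε`) resp. `y = s₁ / (1 - ε - s₀)` (piece B: `2 s₀ ≥ 1 - ε`), in
which the domain is the rectangle `x ∈ [0, (1-ε)/2]` resp. `[(1-ε)/2, 1-ε]`, `y ∈ [0, 1]`:
* `RankActivity.FiveQ` — the six rational parameters `(ε, Λ, β, d₁₀, d₀, c)` and the derived rationals `S, IS0, kap, SS, SM,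
  kapM, IM0` (the `ρ`-affine intercepts / slopes of `fiveIS/fiveIM/fiveIL`, `fiveSS/fiveSM`);
* `RankActivity.termA p` and **`fiveBudget_eq_termA`**: on piece A, `fiveBudget = (termA p).toFun₂ s₀ (s₁/s₀)` (there
  `b₁ = s₁`, `b₂ = s₀`, `e = 1-ε-s₁`, `b₄ = z`; needs `ε ≥ 1/5`);
* `RankActivity.termB1/termB2/termB3 p` and **`fiveBudget_le_termB1/2/3`**: on piece B, `fiveBudget ≤ (termBσ p).toFun₂ s₀
  (s₁/(1-ε-s₀))` for each of the three MONOTONE SELECTIONS `(e, b₄) := (1-ε-s₁, s₀) | (L, s₀) | (L, L)` — `fiveBudget`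
  is nondecreasing in the breakpoints `e` and `b₄` (coefficients `1/c - 1/Λ ≥ 0`, `1/(Λ-c) - 1/c ≥ 0`), and the true
  breakpoints satisfy `e ≤` and `b₄ ≤` each selection, so every selection is a majorant on ALL of piece B and a leaf of
  the certificate may use whichever is locally tight;
* **`RankActivity.R1_of_certs`**: R1 at `p` from the two box claims `∀ (x, y) ∈ [0, η/2] × [0, 1], termA ≤ 1` and
  `∀ (x, y) ∈ [η/2, η] × [0, 1], termB1 ≤ 1 ∨ termB2 ≤ 1 ∨ termB3 ≤ 1` (`η = 1 - ε`).
Support lemmas for stmt-Parity-19069 only; no summit claim.  Standard axioms.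
-/

noncomputable section

open Finset MeasureTheory Set

namespace Summit.Parity.GeneralizedHardyLittlewood.Theses.PolymathEpsThreeCeiling

namespace RankActivity

open Literature.Analysis.ValidatedNumerics.PolyMP

/-- The six rational parameters of a five-constant certificate. -/
structure FiveQ where
  /-- `ε` -/
  ε : ℚ
  /-- the bound `Λ` -/
  Λ : ℚ
  /-- common slope `β` -/
  β : ℚ
  /-- non-minimum increment `d₁₀` -/
  d₁₀ : ℚ
  /-- strict-maximum increment `d₀` -/
  d₀ : ℚ
  /-- two-active larger-atom weight `c` -/
  c : ℚ

namespace FiveQ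

variable (p : FiveQ)

/-- `S = min (2(1-ε)) (1+ε)` (rational `fiveS`). -/
def S : ℚ := min (2 * (1 - p.ε)) (1 + p.ε)
/-- `η = 1 - ε`. -/
def eta : ℚ := 1 - p.ε
/-- `fiveIS` at `ρ = 0`. -/
def IS0 : ℚ := (p.Λ - 2 * p.d₁₀ - p.d₀) / 3
/-- `ρ`-slope of `fiveIS`. -/
def kap : ℚ := (2 * p.d₁₀ / p.S - p.β) / 3
/-- `fiveSS`. -/
def SS : ℚ := (2 * p.β + 2 * p.d₁₀ / p.S) / 3
/-- `fiveSM`. -/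
def SM : ℚ := (2 * p.β - p.d₁₀ / p.S) / 3
/-- `ρ`-slope of `fiveIM` / `fiveIL`. -/
def kapM : ℚ := p.kap - p.d₁₀ / p.S
/-- `fiveIM` at `ρ = 0`. -/
def IM0 : ℚ := p.IS0 + p.d₁₀

end FiveQ

/-- The affine program `c0 + cx · x + c1 · s₁` (`s₁` a sub-program). -/
def aff (c0 cx c1 : ℚ) (s1 : BExprE) : BExprE :=
  BExprE.add (BExprE.add (BExprE.const c0) (BExprE.mul (BExprE.const cx) BExprE.varX))
    (BExprE.mul (BExprE.const c1) s1)

/-- `(1/σ) · log (N · D⁻¹)`. -/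
def logTerm (σ : ℚ) (N D : BExprE) : BExprE :=
  BExprE.mul (BExprE.const (1 / σ)) (BExprE.log (BExprE.mul N (BExprE.inv D)))

/-- The two logarithmic terms common to both pieces, `T1 + T2`, for the sub-program `s1` of `s₁` and the second
breakpoint program given through its `aff` coefficients `(n0, nx, n1)` (numerator of `T2`). -/
def logTerms (p : FiveQ) (s1 : BExprE) (n0 nx n1 : ℚ) : BExprE :=
  BExprE.add
    (logTerm p.SS (aff p.IS0 p.kap (p.kap + p.SS) s1) (aff p.IS0 p.kap p.kap s1))
    (logTerm p.SM (aff n0 nx n1 s1) (aff p.IM0 p.kapM (p.kapM + p.SM) s1))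

/-- Piece A (`2 s₀ ≤ 1 - ε`), coordinates `x = s₀`, `y = s₁/s₀`: the program of `fiveBudget` with `b₁ = s₁`,
`b₂ = s₀`, `e = 1-ε-s₁`, `b₄ = z = 1-ε-s₀`. -/
def termA (p : FiveQ) : BExprE :=
  let s1 := BExprE.mul BExprE.varY BExprE.varX
  BExprE.add (logTerms p s1 p.IM0 (p.kapM + p.SM) p.kapM)
    (BExprE.add
      (logTerm p.SM (aff (p.IM0 + p.d₀ + p.SM * p.eta) (p.kapM - p.SM) p.kapM s1)
        (aff (p.IM0 + p.d₀) (p.kapM + p.SM) p.kapM s1))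
      (aff (2 * p.ε / p.Λ) (1 / p.c - 1 / p.Λ) (-(1 / p.c)) s1))

/-- Piece B (`2 s₀ ≥ 1 - ε`), coordinates `x = s₀`, `y = s₁/(1-ε-s₀)`, selection `(e, b₄) := (1-ε-s₁, s₀)`. -/
def termB1 (p : FiveQ) : BExprE :=
  let s1 := BExprE.mul BExprE.varY (BExprE.sub (BExprE.const p.eta) BExprE.varX)
  BExprE.add (logTerms p s1 (p.IM0 + p.SM * p.eta) (p.kapM - p.SM) p.kapM)
    (aff (-(p.eta / (p.Λ - p.c)) + p.eta / p.c + 2 * p.ε / p.Λ) (2 / (p.Λ - p.c) - 1 / p.c - 1 / p.Λ) (-(1 / p.c)) s1)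

/-- Piece B, selection `(e, b₄) := (L, s₀)`, `L = 1 + ε - s₀ - s₁`. -/
def termB2 (p : FiveQ) : BExprE :=
  let s1 := BExprE.mul BExprE.varY (BExprE.sub (BExprE.const p.eta) BExprE.varX)
  BExprE.add (logTerms p s1 (p.IM0 + p.SM * p.eta) (p.kapM - p.SM) p.kapM)
    (aff (-(p.eta / (p.Λ - p.c)) + (1 + p.ε) / p.c) (2 / (p.Λ - p.c) - 2 / p.c) (-(1 / p.c)) s1)

/-- Piece B, selection `(e, b₄) := (L, L)`. -/
def termB3 (p : FiveQ) : BExprE :=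
  let s1 := BExprE.mul BExprE.varY (BExprE.sub (BExprE.const p.eta) BExprE.varX)
  BExprE.add (logTerms p s1 (p.IM0 + p.SM * p.eta) (p.kapM - p.SM) p.kapM)
    (aff (2 * p.ε / (p.Λ - p.c)) 0 (-(1 / (p.Λ - p.c))) s1)

/-! ### Identification with `fiveBudget` -/

/-- `((p.S : ℚ) : ℝ) = fiveS p.ε`. -/
theorem FiveQ.cast_S (p : FiveQ) : ((p.S : ℚ) : ℝ) = fiveS (p.ε : ℝ) := by
  simp only [FiveQ.S, fiveS]; push_cast; rfl

/-- `log (a / a) = 0` for every real `a` (Mathlib's total `log`, `0/0 = 0`). -/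
private theorem log_div_self' (a : ℝ) : Real.log (a / a) = 0 := by
  rcases eq_or_ne a 0 with h | h
  · simp [h]
  · simp [div_self h]

/-- **Piece A: `fiveBudget` is the program `termA`** (`x = s₀`, `y = s₁/s₀`). -/
theorem fiveBudget_eq_termA (p : FiveQ) (hε : 1 / 5 ≤ p.ε) {s₀ s₁ : ℝ} (hs1 : 0 < s₁) (h10 : s₁ ≤ s₀)
    (hA : 2 * s₀ ≤ 1 - (p.ε : ℝ)) :
    fiveBudget (p.ε : ℝ) (p.Λ : ℝ) (p.β : ℝ) (p.d₁₀ : ℝ) (p.d₀ : ℝ) (p.c : ℝ) s₀ s₁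
      = (termA p).toFun₂ s₀ (s₁ / s₀) := by
  have hs0 : 0 < s₀ := hs1.trans_le h10
  have hε' : (1 : ℝ) / 5 ≤ (p.ε : ℝ) := by
    have h := (Rat.cast_le (K := ℝ)).2 hε; push_cast at h; exact h
  have hyx : s₁ / s₀ * s₀ = s₁ := div_mul_cancel₀ _ hs0.ne'
  -- resolve the breakpoints
  have hb1 : min s₁ (1 - (p.ε : ℝ) - s₀) = s₁ := min_eq_left (by linarith)
  have hb2 : min s₀ (1 - (p.ε : ℝ) - s₀) = s₀ := min_eq_left (by linarith)
  have he : min (1 - (p.ε : ℝ) - s₁) (1 + (p.ε : ℝ) - (s₀ + s₁)) = 1 - (p.ε : ℝ) - s₁ := min_eq_left (by linarith)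
  have hb4 : max (1 - (p.ε : ℝ) - s₀) (min s₀ (1 - (p.ε : ℝ) - s₁)) = 1 - (p.ε : ℝ) - s₀ := by
    rw [min_eq_left (by linarith)]; exact max_eq_left (by linarith)
  have hB : fiveBudget (p.ε : ℝ) (p.Λ : ℝ) (p.β : ℝ) (p.d₁₀ : ℝ) (p.d₀ : ℝ) (p.c : ℝ) s₀ s₁ =
      Real.log ((fiveIS ↑p.ε ↑p.Λ ↑p.β ↑p.d₁₀ ↑p.d₀ (s₀ + s₁) + fiveSS ↑p.ε ↑p.β ↑p.d₁₀ * min s₁ (1 - ↑p.ε - s₀)) /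
          (fiveIS ↑p.ε ↑p.Λ ↑p.β ↑p.d₁₀ ↑p.d₀ (s₀ + s₁) + fiveSS ↑p.ε ↑p.β ↑p.d₁₀ * 0)) / fiveSS ↑p.ε ↑p.β ↑p.d₁₀ +
      Real.log ((fiveIM ↑p.ε ↑p.Λ ↑p.β ↑p.d₁₀ ↑p.d₀ (s₀ + s₁) + fiveSM ↑p.ε ↑p.β ↑p.d₁₀ * min s₀ (1 - ↑p.ε - s₀)) /
          (fiveIM ↑p.ε ↑p.Λ ↑p.β ↑p.d₁₀ ↑p.d₀ (s₀ + s₁) + fiveSM ↑p.ε ↑p.β ↑p.d₁₀ * min s₁ (1 - ↑p.ε - s₀))) /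
          fiveSM ↑p.ε ↑p.β ↑p.d₁₀ +
      Real.log ((fiveIL ↑p.ε ↑p.Λ ↑p.β ↑p.d₁₀ ↑p.d₀ (s₀ + s₁) + fiveSM ↑p.ε ↑p.β ↑p.d₁₀ * (1 - ↑p.ε - s₀)) /
          (fiveIL ↑p.ε ↑p.Λ ↑p.β ↑p.d₁₀ ↑p.d₀ (s₀ + s₁) + fiveSM ↑p.ε ↑p.β ↑p.d₁₀ * min s₀ (1 - ↑p.ε - s₀))) /
          fiveSM ↑p.ε ↑p.β ↑p.d₁₀ +
      (max (1 - ↑p.ε - s₀) (min s₀ (min (1 - ↑p.ε - s₁) (1 + ↑p.ε - (s₀ + s₁)))) - (1 - ↑p.ε - s₀)) / (↑p.Λ - ↑p.c) +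
      (min (1 - ↑p.ε - s₁) (1 + ↑p.ε - (s₀ + s₁)) -
          max (1 - ↑p.ε - s₀) (min s₀ (min (1 - ↑p.ε - s₁) (1 + ↑p.ε - (s₀ + s₁))))) / ↑p.c +
      (1 + ↑p.ε - (s₀ + s₁) - min (1 - ↑p.ε - s₁) (1 + ↑p.ε - (s₀ + s₁))) / ↑p.Λ := rfl
  rw [hB, he, hb1, hb2, hb4]
  simp only [termA, logTerms, logTerm, aff, BExprE.toFun₂, hyx]
  simp only [FiveQ.IS0, FiveQ.kap, FiveQ.SS, FiveQ.SM, FiveQ.kapM, FiveQ.IM0, FiveQ.eta, fiveIS, fiveSS, fiveIM, fiveSM,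
    fiveIL]
  push_cast
  simp only [FiveQ.cast_S, mul_zero, add_zero, sub_self, div_eq_mul_inv]
  ring_nf

/-! ### Piece B: the three monotone selections -/

section PieceB

variable (p : FiveQ) {s₀ s₁ : ℝ}

/-- The two logarithmic terms `T1 + T2` of `fiveBudget` on piece B (`b₁ = s₁`, `b₂ = z`), as a real function. -/
def logs12 (p : FiveQ) (s₀ s₁ : ℝ) : ℝ :=
  Real.log ((fiveIS ↑p.ε ↑p.Λ ↑p.β ↑p.d₁₀ ↑p.d₀ (s₀ + s₁) + fiveSS ↑p.ε ↑p.β ↑p.d₁₀ * s₁) /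
      (fiveIS ↑p.ε ↑p.Λ ↑p.β ↑p.d₁₀ ↑p.d₀ (s₀ + s₁) + fiveSS ↑p.ε ↑p.β ↑p.d₁₀ * 0)) / fiveSS ↑p.ε ↑p.β ↑p.d₁₀ +
  Real.log ((fiveIM ↑p.ε ↑p.Λ ↑p.β ↑p.d₁₀ ↑p.d₀ (s₀ + s₁) + fiveSM ↑p.ε ↑p.β ↑p.d₁₀ * (1 - ↑p.ε - s₀)) /
      (fiveIM ↑p.ε ↑p.Λ ↑p.β ↑p.d₁₀ ↑p.d₀ (s₀ + s₁) + fiveSM ↑p.ε ↑p.β ↑p.d₁₀ * s₁)) / fiveSM ↑p.ε ↑p.β ↑p.d₁₀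

/-- The three linear terms of `fiveBudget` as a function of the breakpoints `(b₄, e)`. -/
def lin3 (p : FiveQ) (s₀ s₁ b₄ e : ℝ) : ℝ :=
  (b₄ - (1 - ↑p.ε - s₀)) / (↑p.Λ - ↑p.c) + (e - b₄) / ↑p.c + (1 + ↑p.ε - (s₀ + s₁) - e) / ↑p.Λ

/-- **`fiveBudget` on piece B is `logs12 + lin3 (b₄, e)` with `b₄ = min s₀ e`, `e = min (1-ε-s₁) L`, and is
MONOTONE in `(b₄, e)`**: for any `b₄' ≥ b₄`, `e' ≥ e` it is at most `logs12 + lin3 (b₄', e')`. -/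
theorem fiveBudget_le_logs12_add_lin3 (hΛ : 0 < p.Λ) (hc1 : p.Λ / 2 ≤ p.c) (hc2 : p.c < p.Λ) (hε : 1 / 5 ≤ p.ε)
    (hB : 1 - (p.ε : ℝ) ≤ 2 * s₀) (hρ : s₀ + s₁ ≤ 1 - (p.ε : ℝ)) {b₄' e' : ℝ}
    (hb : min s₀ (min (1 - ↑p.ε - s₁) (1 + ↑p.ε - (s₀ + s₁))) ≤ b₄')
    (he : min (1 - ↑p.ε - s₁) (1 + ↑p.ε - (s₀ + s₁)) ≤ e') :
    fiveBudget (p.ε : ℝ) (p.Λ : ℝ) (p.β : ℝ) (p.d₁₀ : ℝ) (p.d₀ : ℝ) (p.c : ℝ) s₀ s₁ ≤ logs12 p s₀ s₁ + lin3 p s₀ s₁ b₄' e' := by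
  have hε' : (1 : ℝ) / 5 ≤ (p.ε : ℝ) := by
    have h := (Rat.cast_le (K := ℝ)).2 hε; push_cast at h; exact h
  have hΛ' : (0 : ℝ) < p.Λ := by exact_mod_cast hΛ
  have hc1' : (p.Λ : ℝ) / 2 ≤ p.c := by
    have h := (Rat.cast_le (K := ℝ)).2 hc1; push_cast at h; exact h
  have hc2' : (p.c : ℝ) < p.Λ := by exact_mod_cast hc2
  -- resolve the breakpoints
  have hb1 : min s₁ (1 - (p.ε : ℝ) - s₀) = s₁ := min_eq_left (by linarith)
  have hb2 : min s₀ (1 - (p.ε : ℝ) - s₀) = 1 - (p.ε : ℝ) - s₀ := min_eq_right (by linarith)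
  have hb4 : max (1 - (p.ε : ℝ) - s₀) (min s₀ (min (1 - ↑p.ε - s₁) (1 + ↑p.ε - (s₀ + s₁)))) =
      min s₀ (min (1 - ↑p.ε - s₁) (1 + ↑p.ε - (s₀ + s₁))) :=
    max_eq_right (le_min (by linarith) (le_min (by linarith) (by linarith)))
  have hB' : fiveBudget (p.ε : ℝ) (p.Λ : ℝ) (p.β : ℝ) (p.d₁₀ : ℝ) (p.d₀ : ℝ) (p.c : ℝ) s₀ s₁ =
      Real.log ((fiveIS ↑p.ε ↑p.Λ ↑p.β ↑p.d₁₀ ↑p.d₀ (s₀ + s₁) + fiveSS ↑p.ε ↑p.β ↑p.d₁₀ * min s₁ (1 - ↑p.ε - s₀)) /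
          (fiveIS ↑p.ε ↑p.Λ ↑p.β ↑p.d₁₀ ↑p.d₀ (s₀ + s₁) + fiveSS ↑p.ε ↑p.β ↑p.d₁₀ * 0)) / fiveSS ↑p.ε ↑p.β ↑p.d₁₀ +
      Real.log ((fiveIM ↑p.ε ↑p.Λ ↑p.β ↑p.d₁₀ ↑p.d₀ (s₀ + s₁) + fiveSM ↑p.ε ↑p.β ↑p.d₁₀ * min s₀ (1 - ↑p.ε - s₀)) /
          (fiveIM ↑p.ε ↑p.Λ ↑p.β ↑p.d₁₀ ↑p.d₀ (s₀ + s₁) + fiveSM ↑p.ε ↑p.β ↑p.d₁₀ * min s₁ (1 - ↑p.ε - s₀))) /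
          fiveSM ↑p.ε ↑p.β ↑p.d₁₀ +
      Real.log ((fiveIL ↑p.ε ↑p.Λ ↑p.β ↑p.d₁₀ ↑p.d₀ (s₀ + s₁) + fiveSM ↑p.ε ↑p.β ↑p.d₁₀ * (1 - ↑p.ε - s₀)) /
          (fiveIL ↑p.ε ↑p.Λ ↑p.β ↑p.d₁₀ ↑p.d₀ (s₀ + s₁) + fiveSM ↑p.ε ↑p.β ↑p.d₁₀ * min s₀ (1 - ↑p.ε - s₀))) /
          fiveSM ↑p.ε ↑p.β ↑p.d₁₀ +
      (max (1 - ↑p.ε - s₀) (min s₀ (min (1 - ↑p.ε - s₁) (1 + ↑p.ε - (s₀ + s₁)))) - (1 - ↑p.ε - s₀)) / (↑p.Λ - ↑p.c) +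
      (min (1 - ↑p.ε - s₁) (1 + ↑p.ε - (s₀ + s₁)) -
          max (1 - ↑p.ε - s₀) (min s₀ (min (1 - ↑p.ε - s₁) (1 + ↑p.ε - (s₀ + s₁))))) / ↑p.c +
      (1 + ↑p.ε - (s₀ + s₁) - min (1 - ↑p.ε - s₁) (1 + ↑p.ε - (s₀ + s₁))) / ↑p.Λ := rfl
  rw [hB', hb1, hb2, hb4, log_div_self', zero_div, add_zero]
  -- monotonicity of the linear part in `(b₄, e)`
  set b₄ := min s₀ (min (1 - ↑p.ε - s₁) (1 + ↑p.ε - (s₀ + s₁))) with hb₄def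
  set e := min (1 - ↑p.ε - s₁) (1 + ↑p.ε - (s₀ + s₁)) with hedef
  have hA : 0 ≤ 1 / ((p.Λ : ℝ) - p.c) - 1 / p.c := by
    rw [sub_nonneg]; exact one_div_le_one_div_of_le (by linarith) (by linarith)
  have hBc : 0 ≤ 1 / (p.c : ℝ) - 1 / p.Λ := by
    rw [sub_nonneg]; exact one_div_le_one_div_of_le (by linarith) hc2'.le
  have expand : ∀ b t : ℝ, (b - (1 - ↑p.ε - s₀)) / (↑p.Λ - ↑p.c) + (t - b) / ↑p.c + (1 + ↑p.ε - (s₀ + s₁) - t) / ↑p.Λ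
      = b * (1 / ((p.Λ : ℝ) - p.c) - 1 / p.c) + t * (1 / (p.c : ℝ) - 1 / p.Λ)
        + ((1 + ↑p.ε - (s₀ + s₁)) / ↑p.Λ - (1 - ↑p.ε - s₀) / (↑p.Λ - ↑p.c)) := by
    intro b t; ring
  have t1 := mul_le_mul_of_nonneg_right hb hA
  have t2 := mul_le_mul_of_nonneg_right he hBc
  unfold logs12 lin3
  rw [expand b₄' e']
  linarith [expand b₄ e]

/-- `(termB1 p).toFun₂` in closed form: selection `(b₄, e) := (s₀, 1-ε-s₁)`. -/
theorem toFun₂_termB1 (hs : 1 - (p.ε : ℝ) - s₀ ≠ 0) :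
    (termB1 p).toFun₂ s₀ (s₁ / (1 - ↑p.ε - s₀)) = logs12 p s₀ s₁ + lin3 p s₀ s₁ s₀ (1 - ↑p.ε - s₁) := by
  have hyx : s₁ / (1 - ↑p.ε - s₀) * ((((1 : ℚ) - p.ε : ℚ) : ℝ) - s₀) = s₁ := by
    push_cast; exact div_mul_cancel₀ _ hs
  simp only [termB1, logTerms, logTerm, aff, BExprE.toFun₂, FiveQ.eta, hyx]
  simp only [FiveQ.IS0, FiveQ.kap, FiveQ.SS, FiveQ.SM, FiveQ.kapM, FiveQ.IM0, fiveIS, fiveSS, fiveIM, fiveSM,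
    logs12, lin3]
  push_cast
  simp only [FiveQ.cast_S, mul_zero, add_zero, div_eq_mul_inv]
  ring_nf

/-- `(termB2 p).toFun₂` in closed form: selection `(b₄, e) := (s₀, L)`. -/
theorem toFun₂_termB2 (hs : 1 - (p.ε : ℝ) - s₀ ≠ 0) :
    (termB2 p).toFun₂ s₀ (s₁ / (1 - ↑p.ε - s₀)) = logs12 p s₀ s₁ + lin3 p s₀ s₁ s₀ (1 + ↑p.ε - (s₀ + s₁)) := by
  have hyx : s₁ / (1 - ↑p.ε - s₀) * ((((1 : ℚ) - p.ε : ℚ) : ℝ) - s₀) = s₁ := by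
    push_cast; exact div_mul_cancel₀ _ hs
  simp only [termB2, logTerms, logTerm, aff, BExprE.toFun₂, FiveQ.eta, hyx]
  simp only [FiveQ.IS0, FiveQ.kap, FiveQ.SS, FiveQ.SM, FiveQ.kapM, FiveQ.IM0, fiveIS, fiveSS, fiveIM, fiveSM,
    logs12, lin3]
  push_cast
  simp only [FiveQ.cast_S, mul_zero, add_zero, div_eq_mul_inv]
  ring_nf

/-- `(termB3 p).toFun₂` in closed form: selection `(b₄, e) := (L, L)`. -/
theorem toFun₂_termB3 (hs : 1 - (p.ε : ℝ) - s₀ ≠ 0) :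
    (termB3 p).toFun₂ s₀ (s₁ / (1 - ↑p.ε - s₀)) =
      logs12 p s₀ s₁ + lin3 p s₀ s₁ (1 + ↑p.ε - (s₀ + s₁)) (1 + ↑p.ε - (s₀ + s₁)) := by
  have hyx : s₁ / (1 - ↑p.ε - s₀) * ((((1 : ℚ) - p.ε : ℚ) : ℝ) - s₀) = s₁ := by
    push_cast; exact div_mul_cancel₀ _ hs
  simp only [termB3, logTerms, logTerm, aff, BExprE.toFun₂, FiveQ.eta, hyx]
  simp only [FiveQ.IS0, FiveQ.kap, FiveQ.SS, FiveQ.SM, FiveQ.kapM, FiveQ.IM0, fiveIS, fiveSS, fiveIM, fiveSM,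
    logs12, lin3]
  push_cast
  simp only [FiveQ.cast_S, mul_zero, add_zero, div_eq_mul_inv]
  ring_nf

end PieceB

/-! ### R1 from the two box claims -/

/-- **R1 at `p` from the two kernel box claims**: `termA ≤ 1` on `[0, m] × [0, 1]` and
`termB1 ≤ 1 ∨ termB2 ≤ 1 ∨ termB3 ≤ 1` pointwise on `[m, b] × [0, 1]`, `m = (1-ε)/2`, `b = 1-ε` given as rationals
(the hypotheses are literally `Box2Q.Forall` claims of `Literature.Analysis.ValidatedNumerics.PolyMP` with rational
corners and bound `((1 : ℚ) : ℝ)`). -/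
theorem R1_of_certs (p : FiveQ) (hΛ : 0 < p.Λ) (hc1 : p.Λ / 2 ≤ p.c) (hc2 : p.c < p.Λ) (hε : 1 / 5 ≤ p.ε)
    {m b : ℚ} (hm : (m : ℝ) = (1 - (p.ε : ℝ)) / 2) (hb : (b : ℝ) = 1 - (p.ε : ℝ))
    (hA : ∀ x y : ℝ, ((0 : ℚ) : ℝ) ≤ x → x ≤ (m : ℝ) → ((0 : ℚ) : ℝ) ≤ y → y ≤ ((1 : ℚ) : ℝ) →
      (termA p).toFun₂ x y ≤ ((1 : ℚ) : ℝ))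
    (hB : ∀ x y : ℝ, (m : ℝ) ≤ x → x ≤ (b : ℝ) → ((0 : ℚ) : ℝ) ≤ y → y ≤ ((1 : ℚ) : ℝ) →
      (termB1 p).toFun₂ x y ≤ ((1 : ℚ) : ℝ) ∨ (termB2 p).toFun₂ x y ≤ ((1 : ℚ) : ℝ) ∨
        (termB3 p).toFun₂ x y ≤ ((1 : ℚ) : ℝ)) :
    ∀ s₀ s₁ : ℝ, 0 < s₁ → s₁ ≤ s₀ → s₀ + s₁ ≤ 1 - (p.ε : ℝ) →
      fiveBudget (p.ε : ℝ) (p.Λ : ℝ) (p.β : ℝ) (p.d₁₀ : ℝ) (p.d₀ : ℝ) (p.c : ℝ) s₀ s₁ ≤ 1 := by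
  intro s₀ s₁ hs1 h10 hρ
  have hs0 : 0 < s₀ := hs1.trans_le h10
  rcases le_total (2 * s₀) (1 - (p.ε : ℝ)) with hle | hge
  · -- piece A: `x = s₀`, `y = s₁ / s₀`
    have hy0 : 0 ≤ s₁ / s₀ := div_nonneg hs1.le hs0.le
    have hy1 : s₁ / s₀ ≤ 1 := (div_le_one hs0).2 h10
    have h := hA s₀ (s₁ / s₀) (by exact_mod_cast hs0.le) (by rw [hm]; linarith) (by exact_mod_cast hy0)
      (by exact_mod_cast hy1)
    rw [fiveBudget_eq_termA p hε hs1 h10 hle]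
    simpa using h
  · -- piece B: `x = s₀`, `y = s₁ / (1 - ε - s₀)`
    have hη : 0 < 1 - (p.ε : ℝ) - s₀ := by linarith
    have hy0 : 0 ≤ s₁ / (1 - ↑p.ε - s₀) := div_nonneg hs1.le hη.le
    have hy1 : s₁ / (1 - ↑p.ε - s₀) ≤ 1 := (div_le_one hη).2 (by linarith)
    have hmb : min s₀ (min (1 - ↑p.ε - s₁) (1 + ↑p.ε - (s₀ + s₁))) ≤ s₀ := min_le_left _ _
    have hme1 : min (1 - ↑p.ε - s₁) (1 + ↑p.ε - (s₀ + s₁)) ≤ 1 - ↑p.ε - s₁ := min_le_left _ _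
    have hme2 : min (1 - ↑p.ε - s₁) (1 + ↑p.ε - (s₀ + s₁)) ≤ 1 + ↑p.ε - (s₀ + s₁) := min_le_right _ _
    have hmbL : min s₀ (min (1 - ↑p.ε - s₁) (1 + ↑p.ε - (s₀ + s₁))) ≤ 1 + ↑p.ε - (s₀ + s₁) :=
      (min_le_right _ _).trans hme2
    rcases hB s₀ (s₁ / (1 - ↑p.ε - s₀)) (by rw [hm]; linarith) (by rw [hb]; linarith)
      (by exact_mod_cast hy0) (by exact_mod_cast hy1) with h | h | h
    · have h' : (termB1 p).toFun₂ s₀ (s₁ / (1 - ↑p.ε - s₀)) ≤ 1 := by simpa using h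
      calc _ ≤ logs12 p s₀ s₁ + lin3 p s₀ s₁ s₀ (1 - ↑p.ε - s₁) :=
            fiveBudget_le_logs12_add_lin3 p hΛ hc1 hc2 hε hge hρ hmb hme1
        _ = (termB1 p).toFun₂ s₀ (s₁ / (1 - ↑p.ε - s₀)) := (toFun₂_termB1 p hη.ne').symm
        _ ≤ 1 := h'
    · have h' : (termB2 p).toFun₂ s₀ (s₁ / (1 - ↑p.ε - s₀)) ≤ 1 := by simpa using h
      calc _ ≤ logs12 p s₀ s₁ + lin3 p s₀ s₁ s₀ (1 + ↑p.ε - (s₀ + s₁)) :=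
            fiveBudget_le_logs12_add_lin3 p hΛ hc1 hc2 hε hge hρ hmb hme2
        _ = (termB2 p).toFun₂ s₀ (s₁ / (1 - ↑p.ε - s₀)) := (toFun₂_termB2 p hη.ne').symm
        _ ≤ 1 := h'
    · have h' : (termB3 p).toFun₂ s₀ (s₁ / (1 - ↑p.ε - s₀)) ≤ 1 := by simpa using h
      calc _ ≤ logs12 p s₀ s₁ + lin3 p s₀ s₁ (1 + ↑p.ε - (s₀ + s₁)) (1 + ↑p.ε - (s₀ + s₁)) :=
            fiveBudget_le_logs12_add_lin3 p hΛ hc1 hc2 hε hge hρ hmbL hme2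
        _ = (termB3 p).toFun₂ s₀ (s₁ / (1 - ↑p.ε - s₀)) := (toFun₂_termB3 p hη.ne').symm
        _ ≤ 1 := h'

end RankActivity

end Summit.Parity.GeneralizedHardyLittlewood.Theses.PolymathEpsThreeCeiling

end
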